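import Summits.CriticalPhenomena.PercolationContinuityZ3.Theorems.PercNearOneGluingNoHeavyQuantIndepBlobGapCalculus
import HarnessLib

/-!
# QUANT lane R8, T-DIB: two elementary DEVICES for the restricted tail `TL_U` of a light cloud — big lights factor out, and the
# all-open lower bound (P1-SURPLUS §23.11)

builds on p205010 (kernel theorem, internal audit signed; external expert review pending)

Support file (`--supports stmt-CriticalPhenomena-4575`), QUANT lane seat prim-quant-p1 (gen 12); memo
`run/shared/lean/prim/quant/P1-SURPLUS.md` §23.11–23.12.  Theorems only; no definitions, no sorries, standard axioms.

`TL_U(t) = Σ_{s ⊆ U} w_U(s)·𝟙[t ≤ Σ_{i∈s} a_i]` is the tail of the open mass of the sub-cloud `U` (`…GapCalculus`).  The device programme for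
the remaining chord cells of Conjecture J′ (memo §23.11) bounds `1 − TL_U(u+1) = P(Λ_U ≤ u)` by splitting `U` at the level: lights of size
`> u` ("big") must all be closed, the rest ("small") is bounded by elementary devices.  This file proves the two combinatorial ones:
* `Quant.IndepBlob.tailU_insert_big` — a light `k` with `a k ≥ t`: `TL_{U+k}(t) = p k + (1 − p k)·TL_U(t)`;
* `Quant.IndepBlob.one_sub_tailU_union_big` — for a set `B` of lights all of size `≥ t`, disjoint from `U`:
  `1 − TL_{U ∪ B}(t) = Π_{k∈B}(1 − p k) · (1 − TL_U(t))` (big lights factor out of the lower tail);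
* `Quant.IndepBlob.prod_le_tailU` — the ALL-OPEN device: `t ≤ Σ_{i∈U} a_i ⟹ Π_{i∈U} p_i ≤ TL_U(t)`.
(The Cantelli and at-most-one-open devices are left to the next seat.)  [cite: KozmaNitzan2024, Conjecture 3 (p. 15)] (the gluing rows
served); [this work].
-/

namespace Summit.CriticalPhenomena.PercolationContinuityZ3.Theorems

namespace Quant

namespace IndepBlob

open Finset

variable {κ : Type*} [DecidableEq κ]

/-- **A big light factors out**: for `k ∉ U` with `t ≤ a k`, `TL_{U+k}(t) = p k + (1 − p k)·TL_U(t)`. [this work] -/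
theorem tailU_insert_big (p : κ → ℝ) (a : κ → ℕ) (U : Finset κ) (k : κ) (hk : k ∉ U) (t : ℕ) (ht : t ≤ a k) :
    ∑ s ∈ (insert k U).powerset, (∏ i ∈ insert k U, (if i ∈ s then p i else 1 - p i)) *
        (if t ≤ ∑ i ∈ s, a i then (1 : ℝ) else 0) =
      p k + (1 - p k) * ∑ s ∈ U.powerset, (∏ i ∈ U, (if i ∈ s then p i else 1 - p i)) *
          (if t ≤ ∑ i ∈ s, a i then (1 : ℝ) else 0) := by
  rw [tailU_insert p a U k hk t, Nat.sub_eq_zero_of_le ht, tailU_zero]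
  ring

/-- **All big lights factor out of the lower tail**: if every `k ∈ B` has `t ≤ a k` and `B` is disjoint from `U`, then
`1 − TL_{U ∪ B}(t) = (Π_{k∈B} (1 − p k)) · (1 − TL_U(t))`. [this work] -/
theorem one_sub_tailU_union_big (p : κ → ℝ) (a : κ → ℕ) (U : Finset κ) (t : ℕ) :
    ∀ B : Finset κ, Disjoint U B → (∀ k ∈ B, t ≤ a k) →
      1 - ∑ s ∈ (U ∪ B).powerset, (∏ i ∈ U ∪ B, (if i ∈ s then p i else 1 - p i)) *
          (if t ≤ ∑ i ∈ s, a i then (1 : ℝ) else 0) =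
        (∏ k ∈ B, (1 - p k)) * (1 - ∑ s ∈ U.powerset, (∏ i ∈ U, (if i ∈ s then p i else 1 - p i)) *
          (if t ≤ ∑ i ∈ s, a i then (1 : ℝ) else 0)) := by
  intro B
  induction B using Finset.induction_on with
  | empty =>
    intro _ _
    rw [Finset.union_empty, Finset.prod_empty, one_mul]
  | @insert k B hkB ih =>
    intro hdisj hbig
    have hkU : k ∉ U := fun h => (Finset.disjoint_left.1 hdisj h) (Finset.mem_insert_self k B)
    have hdisj' : Disjoint U B := Finset.disjoint_of_subset_right (Finset.subset_insert k B) hdisj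
    have hbig' : ∀ k' ∈ B, t ≤ a k' := fun k' hk' => hbig k' (Finset.mem_insert_of_mem hk')
    have hk' : k ∉ U ∪ B := by
      rw [Finset.mem_union, not_or]; exact ⟨hkU, hkB⟩
    rw [Finset.union_insert, tailU_insert_big p a (U ∪ B) k hk' t (hbig k (Finset.mem_insert_self k B)),
      Finset.prod_insert hkB]
    have := ih hdisj' hbig'
    calc 1 - (p k + (1 - p k) * ∑ s ∈ (U ∪ B).powerset, (∏ i ∈ U ∪ B, (if i ∈ s then p i else 1 - p i)) *
            (if t ≤ ∑ i ∈ s, a i then (1 : ℝ) else 0))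
        = (1 - p k) * (1 - ∑ s ∈ (U ∪ B).powerset, (∏ i ∈ U ∪ B, (if i ∈ s then p i else 1 - p i)) *
            (if t ≤ ∑ i ∈ s, a i then (1 : ℝ) else 0)) := by ring
      _ = (1 - p k) * ((∏ k ∈ B, (1 - p k)) * (1 - ∑ s ∈ U.powerset, (∏ i ∈ U, (if i ∈ s then p i else 1 - p i)) *
            (if t ≤ ∑ i ∈ s, a i then (1 : ℝ) else 0))) := by rw [this]
      _ = _ := by ring

/-- **The all-open device**: if the whole sub-cloud reaches the level (`t ≤ Σ_{i∈U} a_i`) then `Π_{i∈U} p_i ≤ TL_U(t)` (gates in `[0,1]`).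
[this work] -/
theorem prod_le_tailU (p : κ → ℝ) (a : κ → ℕ) :
    ∀ (U : Finset κ) (t : ℕ), (∀ k ∈ U, 0 ≤ p k) → (∀ k ∈ U, p k ≤ 1) → t ≤ ∑ i ∈ U, a i →
      ∏ i ∈ U, p i ≤ ∑ s ∈ U.powerset, (∏ i ∈ U, (if i ∈ s then p i else 1 - p i)) *
          (if t ≤ ∑ i ∈ s, a i then (1 : ℝ) else 0) := by
  intro U
  induction U using Finset.induction_on with
  | empty =>
    intro t _ _ ht
    rw [Finset.sum_empty] at ht
    have ht0 : t = 0 := by omega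
    subst ht0
    rw [tailU_zero, Finset.prod_empty]
  | @insert k U hk ih =>
    intro t hp0 hp1 ht
    have hp0U : ∀ i ∈ U, 0 ≤ p i := fun i hi => hp0 i (Finset.mem_insert_of_mem hi)
    have hp1U : ∀ i ∈ U, p i ≤ 1 := fun i hi => hp1 i (Finset.mem_insert_of_mem hi)
    have hpk0 : 0 ≤ p k := hp0 k (Finset.mem_insert_self k U)
    have hpk1 : p k ≤ 1 := hp1 k (Finset.mem_insert_self k U)
    rw [Finset.sum_insert hk] at ht
    have ht' : t - a k ≤ ∑ i ∈ U, a i := by omega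
    have hIH := ih (t - a k) hp0U hp1U ht'
    have hnn := tailU_nonneg p a U hp0U hp1U t
    rw [tailU_insert p a U k hk t, Finset.prod_insert hk]
    have h1 : p k * ∏ i ∈ U, p i ≤ p k * ∑ s ∈ U.powerset, (∏ i ∈ U, (if i ∈ s then p i else 1 - p i)) *
        (if t - a k ≤ ∑ i ∈ s, a i then (1 : ℝ) else 0) := mul_le_mul_of_nonneg_left hIH hpk0
    have h2 : 0 ≤ (1 - p k) * ∑ s ∈ U.powerset, (∏ i ∈ U, (if i ∈ s then p i else 1 - p i)) *
        (if t ≤ ∑ i ∈ s, a i then (1 : ℝ) else 0) := mul_nonneg (by linarith) hnn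
    linarith

/-! ### Appended (p1 g12, second batch): monotonicity in the cloud and the 'at most one open' device -/

/-- **Adding a light does not decrease the tail**: for `k ∉ U` (gates of `U` in `[0,1]`, `0 ≤ p k`), `TL_U(t) ≤ TL_{U+k}(t)`. [this work] -/
theorem tailU_le_insert (p : κ → ℝ) (a : κ → ℕ) (U : Finset κ) (k : κ) (hk : k ∉ U)
    (hp0 : ∀ i ∈ U, 0 ≤ p i) (hp1 : ∀ i ∈ U, p i ≤ 1) (hk0 : 0 ≤ p k) (t : ℕ) :
    ∑ s ∈ U.powerset, (∏ i ∈ U, (if i ∈ s then p i else 1 - p i)) * (if t ≤ ∑ i ∈ s, a i then (1 : ℝ) else 0) ≤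
      ∑ s ∈ (insert k U).powerset, (∏ i ∈ insert k U, (if i ∈ s then p i else 1 - p i)) *
        (if t ≤ ∑ i ∈ s, a i then (1 : ℝ) else 0) := by
  rw [tailU_insert p a U k hk t]
  have hanti := tailU_antitone p a U hp0 hp1 (Nat.sub_le t (a k))
  have h1 := mul_le_mul_of_nonneg_left hanti hk0
  nlinarith [h1]

/-- **One open light suffices**: if every light of `F` alone reaches the level (`t ≤ a i` for `i ∈ F`), then
`1 − Π_{i∈F}(1 − p i) ≤ TL_F(t)`. [this work] -/
theorem one_sub_prod_le_tailU (p : κ → ℝ) (a : κ → ℕ) :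
    ∀ (F : Finset κ) (t : ℕ), (∀ i ∈ F, 0 ≤ p i) → (∀ i ∈ F, p i ≤ 1) → (∀ i ∈ F, t ≤ a i) →
      1 - ∏ i ∈ F, (1 - p i) ≤ ∑ s ∈ F.powerset, (∏ i ∈ F, (if i ∈ s then p i else 1 - p i)) *
          (if t ≤ ∑ i ∈ s, a i then (1 : ℝ) else 0) := by
  intro F
  induction F using Finset.induction_on with
  | empty =>
    intro t _ _ _
    rw [Finset.prod_empty]
    have := tailU_nonneg p a (∅ : Finset κ) (by simp) (by simp) t
    linarith
  | @insert k F hk ih =>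
    intro t hp0 hp1 hbig
    have hp0F : ∀ i ∈ F, 0 ≤ p i := fun i hi => hp0 i (Finset.mem_insert_of_mem hi)
    have hp1F : ∀ i ∈ F, p i ≤ 1 := fun i hi => hp1 i (Finset.mem_insert_of_mem hi)
    have hbigF : ∀ i ∈ F, t ≤ a i := fun i hi => hbig i (Finset.mem_insert_of_mem hi)
    have hpk1 : p k ≤ 1 := hp1 k (Finset.mem_insert_self k F)
    rw [tailU_insert_big p a F k hk t (hbig k (Finset.mem_insert_self k F)), Finset.prod_insert hk]
    have hIH := ih t hp0F hp1F hbigF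
    have h1 := mul_le_mul_of_nonneg_left hIH (show 0 ≤ 1 - p k by linarith)
    nlinarith [h1]

/-- **The 'at most one open' device**: if any two lights of `F` together reach the level (`t ≤ a i + a j` for `i ≠ j` in `F`), then
`TL_F(t) ≥ 1 − Π_{F}(1 − p) − Σ_{i∈F} p_i Π_{j ∈ F∖i}(1 − p_j)` (`= P(at least two lights of F are open)`).  By `tailU_le_insert` the
same bound holds for every cloud containing `F`. [this work] -/
theorem two_open_le_tailU (p : κ → ℝ) (a : κ → ℕ) :
    ∀ (F : Finset κ) (t : ℕ), (∀ i ∈ F, 0 ≤ p i) → (∀ i ∈ F, p i ≤ 1) →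
      (∀ i ∈ F, ∀ j ∈ F, i ≠ j → t ≤ a i + a j) →
      1 - ∏ i ∈ F, (1 - p i) - ∑ i ∈ F, p i * ∏ j ∈ F.erase i, (1 - p j) ≤
        ∑ s ∈ F.powerset, (∏ i ∈ F, (if i ∈ s then p i else 1 - p i)) * (if t ≤ ∑ i ∈ s, a i then (1 : ℝ) else 0) := by
  intro F
  induction F using Finset.induction_on with
  | empty =>
    intro t _ _ _
    rw [Finset.prod_empty, Finset.sum_empty]
    have := tailU_nonneg p a (∅ : Finset κ) (by simp) (by simp) t
    linarith
  | @insert k F hk ih =>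
    intro t hp0 hp1 hpair
    have hp0F : ∀ i ∈ F, 0 ≤ p i := fun i hi => hp0 i (Finset.mem_insert_of_mem hi)
    have hp1F : ∀ i ∈ F, p i ≤ 1 := fun i hi => hp1 i (Finset.mem_insert_of_mem hi)
    have hpairF : ∀ i ∈ F, ∀ j ∈ F, i ≠ j → t ≤ a i + a j :=
      fun i hi j hj hij => hpair i (Finset.mem_insert_of_mem hi) j (Finset.mem_insert_of_mem hj) hij
    have hpk0 : 0 ≤ p k := hp0 k (Finset.mem_insert_self k F)
    have hpk1 : p k ≤ 1 := hp1 k (Finset.mem_insert_self k F)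
    -- after conditioning on `k`: open ⟹ one more light of `F` suffices (level `t − a k ≤ a i`); closed ⟹ induction hypothesis
    have hbig : ∀ i ∈ F, t - a k ≤ a i := by
      intro i hi
      have hik : k ≠ i := fun h => hk (h ▸ hi)
      have := hpair k (Finset.mem_insert_self k F) i (Finset.mem_insert_of_mem hi) hik
      omega
    have hopen := one_sub_prod_le_tailU p a F (t - a k) hp0F hp1F hbig
    have hclosed := ih t hp0F hp1F hpairF
    rw [tailU_insert p a F k hk t]
    -- the closed form on `insert k F`
    have hsum : ∑ i ∈ insert k F, p i * ∏ j ∈ (insert k F).erase i, (1 - p j) =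
        p k * ∏ j ∈ F, (1 - p j) + ∑ i ∈ F, p i * ((1 - p k) * ∏ j ∈ F.erase i, (1 - p j)) := by
      rw [Finset.sum_insert hk, Finset.erase_insert hk]
      congr 1
      refine Finset.sum_congr rfl fun i hi => ?_
      have hik : k ≠ i := fun h => hk (h ▸ hi)
      rw [Finset.erase_insert_of_ne hik, Finset.prod_insert (fun h => hk (Finset.mem_of_mem_erase h))]
    rw [hsum, Finset.prod_insert hk]
    have h1 := mul_le_mul_of_nonneg_left hopen hpk0
    have h2 := mul_le_mul_of_nonneg_left hclosed (show 0 ≤ 1 - p k by linarith)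
    have e : ∑ i ∈ F, p i * ((1 - p k) * ∏ j ∈ F.erase i, (1 - p j)) = (1 - p k) * ∑ i ∈ F, p i * ∏ j ∈ F.erase i, (1 - p j) := by
      rw [Finset.mul_sum]
      refine Finset.sum_congr rfl fun i _ => ?_
      ring
    rw [e]
    have key : p k * (∑ s ∈ F.powerset, (∏ i ∈ F, (if i ∈ s then p i else 1 - p i)) *
          (if t - a k ≤ ∑ i ∈ s, a i then (1 : ℝ) else 0)) +
        (1 - p k) * (∑ s ∈ F.powerset, (∏ i ∈ F, (if i ∈ s then p i else 1 - p i)) *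
          (if t ≤ ∑ i ∈ s, a i then (1 : ℝ) else 0)) -
        (1 - (1 - p k) * ∏ i ∈ F, (1 - p i) -
          (p k * ∏ j ∈ F, (1 - p j) + (1 - p k) * ∑ i ∈ F, p i * ∏ j ∈ F.erase i, (1 - p j))) =
        (p k * (∑ s ∈ F.powerset, (∏ i ∈ F, (if i ∈ s then p i else 1 - p i)) *
          (if t - a k ≤ ∑ i ∈ s, a i then (1 : ℝ) else 0)) - p k * (1 - ∏ i ∈ F, (1 - p i))) +
        ((1 - p k) * (∑ s ∈ F.powerset, (∏ i ∈ F, (if i ∈ s then p i else 1 - p i)) *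
          (if t ≤ ∑ i ∈ s, a i then (1 : ℝ) else 0)) -
          (1 - p k) * (1 - ∏ i ∈ F, (1 - p i) - ∑ i ∈ F, p i * ∏ j ∈ F.erase i, (1 - p j))) := by ring
    linarith [h1, h2, key]

/-! ### Appended (p1 g12, third batch): monotonicity under inclusion of clouds -/

/-- **A bigger cloud has a bigger tail**: for disjoint `U`, `B` with gates in `[0,1]`, `TL_U(t) ≤ TL_{U ∪ B}(t)`.  Hence every device
proved for a sub-family (`prod_le_tailU`, `two_open_le_tailU`, …) bounds the tail of the whole cloud. [this work] -/
theorem tailU_le_union (p : κ → ℝ) (a : κ → ℕ) (U : Finset κ) (hp0 : ∀ i ∈ U, 0 ≤ p i) (hp1 : ∀ i ∈ U, p i ≤ 1) (t : ℕ) :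
    ∀ B : Finset κ, Disjoint U B → (∀ i ∈ B, 0 ≤ p i) → (∀ i ∈ B, p i ≤ 1) →
      ∑ s ∈ U.powerset, (∏ i ∈ U, (if i ∈ s then p i else 1 - p i)) * (if t ≤ ∑ i ∈ s, a i then (1 : ℝ) else 0) ≤
        ∑ s ∈ (U ∪ B).powerset, (∏ i ∈ U ∪ B, (if i ∈ s then p i else 1 - p i)) *
          (if t ≤ ∑ i ∈ s, a i then (1 : ℝ) else 0) := by
  intro B
  induction B using Finset.induction_on with
  | empty =>
    intro _ _ _
    rw [Finset.union_empty]
  | @insert k B hkB ih =>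
    intro hdisj hB0 hB1
    have hkU : k ∉ U := fun h => (Finset.disjoint_left.1 hdisj h) (Finset.mem_insert_self k B)
    have hdisj' : Disjoint U B := Finset.disjoint_of_subset_right (Finset.subset_insert k B) hdisj
    have hB0' : ∀ i ∈ B, 0 ≤ p i := fun i hi => hB0 i (Finset.mem_insert_of_mem hi)
    have hB1' : ∀ i ∈ B, p i ≤ 1 := fun i hi => hB1 i (Finset.mem_insert_of_mem hi)
    have hk' : k ∉ U ∪ B := by rw [Finset.mem_union, not_or]; exact ⟨hkU, hkB⟩
    have hUB0 : ∀ i ∈ U ∪ B, 0 ≤ p i := by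
      intro i hi; rw [Finset.mem_union] at hi
      rcases hi with h | h
      · exact hp0 i h
      · exact hB0' i h
    have hUB1 : ∀ i ∈ U ∪ B, p i ≤ 1 := by
      intro i hi; rw [Finset.mem_union] at hi
      rcases hi with h | h
      · exact hp1 i h
      · exact hB1' i h
    rw [Finset.union_insert]
    exact le_trans (ih hdisj' hB0' hB1')
      (tailU_le_insert p a (U ∪ B) k hk' hUB0 hUB1 (hB0 k (Finset.mem_insert_self k B)) t)

end IndepBlob

end Quant

end Summit.CriticalPhenomena.PercolationContinuityZ3.Theorems
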